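import Summits.ResolutionOfSingularities.ResolutionOfSingularities.Theses.DefectlessFrames
import Summits.ResolutionOfSingularities.ResolutionOfSingularities.Theorems.RegularBlowupsDesingularization
import Literature.AlgebraicGeometry.Resolution.KedlayaEtaleCovers
import Literature.AlgebraicGeometry.Resolution.ProjectiveBirationalBlowup
import HarnessLib

/-!
# Crux `PatchingRelPerfect` (stmt-ResolutionOfSingularities-16161) — idea `kedlaya-norm-transport`, first lemmas

Sketch for the crux-ideate card (ideator 2, round 1). Elaboration only (no proofs of the stubs).

* `AffineSpaceSingAdmPerfect p` — THE ATOM: Sing-admissible blow-up desingularization of blowings up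
  of AFFINE SPACE `𝔸ⁿ_k = Spec k[x₁,…,xₙ]` over PERFECT fields `k` of characteristic `p`
  (= the tree's `RegularBlowupSingAdmissibleResolution(QProj)` with `U := 𝔸ⁿ_k`, `k` perfect).
* `KedlayaAvoidance` — Kedlaya 2005 Thm 1 (tree fact `Kedlaya2004_finite_etale_off_hyperplane`) WITH
  the refinements the transport needs: the chart lands in a prescribed open `U ∋ s`, `s ↦` chart,
  one-fibre avoidance `f⁻¹(f s) ∩ F = {s}` for a closed `F ∌ generic point`, and trivial residue
  extension at `s`.
* `SingAdmQProjPerfect p` — the tree's `RegularBlowupSingAdmissibleResolutionQProj p` restricted to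
  perfect ground fields (the dead line's atom B4qp/SingAdm_qp, perfect copy).
* `TransportStatement p` — the theorem the line builds: `KedlayaAvoidance → AffineSpaceSingAdmPerfect p →
  SingAdmQProjPerfect p` (Galois-norm descent of the blown-up ideal + noetherian induction on `U`).
* `DownstreamStatement` — `Liu2002Thm8124Projective → (∀ p prime, SingAdmQProjPerfect p) → PatchingRelPerfect`
  (per-perfect-field re-run of `Theorems.resolutionInChar_of_liu_of_regularBlowupSingAdmQProj_of_lurel`).
-/

noncomputable section

set_option linter.dupNamespace false

namespace Summit.ResolutionOfSingularities.ResolutionOfSingularities.Cruxes.PatchingRelPerfect.KedlayaNormTransport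

open CategoryTheory AlgebraicGeometry TopologicalSpace
open Literature.AlgebraicGeometry.Resolution
open Summit.ResolutionOfSingularities.ResolutionOfSingularities.Theses.DefectlessFrames (PatchingRelPerfect)

universe u

/-- **ATOM `AffineSpaceSingAdmPerfect p`** — for `k` perfect of characteristic `p`, every `n`, every
non-zero ideal sheaf `I` on `𝔸ⁿ_k = Spec k[x₁,…,xₙ]` and every blowing up `η : V → 𝔸ⁿ_k` along `I`,
there is a non-zero ideal sheaf `J` on `V`, cosupported in the SINGULAR locus of `V`, whose blowing
up has regular source. (`RegularBlowupSingAdmissibleResolution p` of the tree with `U := 𝔸ⁿ_k`,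
`k` perfect; the punctual form near one closed fibre suffices, see the card.) -/
def AffineSpaceSingAdmPerfect (p : ℕ) : Prop :=
  ∀ (k : Type u) [Field k] [CharP k p] [PerfectField k] (n : ℕ) (V : Scheme.{u})
    (η : V ⟶ Spec (.of (MvPolynomial (Fin n) k)))
    (I : (Spec (CommRingCat.of (MvPolynomial (Fin n) k))).IdealSheafData),
    I ≠ ⊥ → IsBlowup η I →
      ∃ (J : V.IdealSheafData) (V' : Scheme.{u}) (π : V' ⟶ V),
        J ≠ ⊥ ∧ (∀ x : V, x ∈ J.support → ¬ IsRegularLocalRing (V.presheaf.stalk x)) ∧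
          IsBlowup π J ∧ Scheme.IsRegular V'

/-- **`KedlayaAvoidance`** — Kedlaya, J. Algebraic Geom. 14 (2005), Thm 1, in the tree's typing
(`Kedlaya2004_finite_etale_off_hyperplane`: `X` integral with a finite `g : X → ℙᴺ_k`, `k` perfect of
characteristic `p`; a finite surjective `f : X → ℙⁿ_k` étale over the chart `D₊(xₙ) ≅ 𝔸ⁿ`), with the
clauses the transport consumes: (c)/(d) of the printed theorem (`D := X ∖ U ↦ H`, `S := {s} ↦ 𝔸ⁿ`:
`f⁻¹(D₊(xₙ)) ⊆ U`, `f s ∈ D₊(xₙ)`) and the NEW one-fibre avoidance clause (`f⁻¹(f s) ∩ F = {s}` for a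
closed `F ≠ X`, trivial residue field extension at `s`) — to be proved from Kedlaya's construction
(`uᵢ = sᵢ s^{m(pr-1)} t^{p(l-1)} + tᵢᵖ`: perturb the `tᵢ` by sections vanishing on `Z`; incidence count
over infinite `k`, Poonen's closed-point sieve over finite `k`). [cite: Kedlaya2004, Thm 1] -/
def KedlayaAvoidance : Prop :=
  ∀ (p : ℕ), p.Prime → ∀ (k : Type u) [Field k] [CharP k p] [PerfectField k] (N : ℕ)
    (X : Scheme.{u}) (g : X ⟶ (Literature.AlgebraicGeometry.Motives.projectiveSpace N k).left),
    IsIntegral X → IsFinite g →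
    ∀ (U : X.Opens) (s : X) (F : Set X), s ∈ U → IsClosed ({s} : Set X) →
      IsRegularLocalRing (X.presheaf.stalk s) → IsClosed F → F ≠ Set.univ →
    ∃ (n : ℕ) (f : X ⟶ (Literature.AlgebraicGeometry.Motives.projectiveSpace n k).left),
      f ≫ (Literature.AlgebraicGeometry.Motives.projectiveSpace n k).hom = g ≫ (Literature.AlgebraicGeometry.Motives.projectiveSpace N k).hom ∧
      IsFinite f ∧ Function.Surjective f.base ∧
      (letI := MvPolynomial.gradedAlgebra (σ := Fin (n + 1)) (R := k)
       Etale (f ∣_ (Proj.basicOpen (MvPolynomial.homogeneousSubmodule (Fin (n + 1)) k)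
         (MvPolynomial.X (Fin.last n)))) ∧
       f.base s ∈ (Proj.basicOpen (MvPolynomial.homogeneousSubmodule (Fin (n + 1)) k)
         (MvPolynomial.X (Fin.last n))) ∧
       f ⁻¹ᵁ (Proj.basicOpen (MvPolynomial.homogeneousSubmodule (Fin (n + 1)) k)
         (MvPolynomial.X (Fin.last n))) ≤ U) ∧
      (∀ x ∈ F, f.base x = f.base s → x = s) ∧ IsIso (f.residueFieldMap s)

/-- **`SingAdmQProjPerfect p`** — `RegularBlowupSingAdmissibleResolutionQProj p` of the tree
(`Theorems/RegularBlowupsDesingularization.lean`, the dead line's atom SingAdm_qp) restricted to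
PERFECT ground fields. -/
def SingAdmQProjPerfect (p : ℕ) : Prop :=
  ∀ (k : Type u) [Field k] [CharP k p] [PerfectField k] (U V : Scheme.{u}) (f : U ⟶ Spec (.of k))
    (η : V ⟶ U) (I : U.IdealSheafData),
    IsSeparated f → LocallyOfFiniteType f → QuasiCompact f → IsIntegral U → Scheme.IsRegular U →
    (∃ (P : Scheme.{u}) (πP : P ⟶ Spec (.of k)) (j : U ⟶ P),
      Literature.AlgebraicGeometry.Motives.IsProjectiveOver (Over.mk πP) ∧
        IsOpenImmersion j ∧ j ≫ πP = f) →
    I ≠ ⊥ → IsBlowup η I →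
      ∃ (J : V.IdealSheafData) (V' : Scheme.{u}) (π : V' ⟶ V),
        J ≠ ⊥ ∧ (∀ x : V, x ∈ J.support → ¬ IsRegularLocalRing (V.presheaf.stalk x)) ∧
          IsBlowup π J ∧ Scheme.IsRegular V'

/-- The all-fields atom of the twin crux gives the perfect one (sanity; proved). [folklore] -/
theorem singAdmQProjPerfect_of_allFields {p : ℕ}
    (h : RegularBlowupSingAdmissibleResolutionQProj.{u} p) : SingAdmQProjPerfect.{u} p :=
  fun k _ _ _ U V f η I h₁ h₂ h₃ h₄ h₅ hqp hI hη => h k U V f η I h₁ h₂ h₃ h₄ h₅ hqp hI hη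

/-- Affine space is its own Kedlaya chart: the perfect quasi-projective atom gives the affine one
(sanity direction; the converse is `TransportStatement`). Stated, not proved here (needs the
quasi-projectivity witness `𝔸ⁿ ⊆ ℙⁿ` in the tree's `IsProjectiveOver` typing). -/
def AffineOfQProjStatement (p : ℕ) : Prop :=
  SingAdmQProjPerfect.{u} p → AffineSpaceSingAdmPerfect.{u} p

/-- **THE TRANSPORT THEOREM (to build)**: Kedlaya charts with avoidance + the affine atom give the
Sing-admissible atom for every smooth quasi-projective base over a perfect field, by Galois-norm
descent of the blown-up ideal to `𝔸ⁿ`, étale pull-back of the resolving Sing-supported ideal,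
extension by closure inside `Sing`, and noetherian induction on the base. -/
def TransportStatement (p : ℕ) : Prop :=
  KedlayaAvoidance.{u} → AffineSpaceSingAdmPerfect.{u} p → SingAdmQProjPerfect.{u} p

/-- **DOWNSTREAM (tree re-run, fibrewise over perfect fields)**: with Liu 2002 Thm 8.1.24 (PROVED in the
tree, `Liu2002Thm8124Projective_holds`), the perfect quasi-projective atom in every prime
characteristic gives the crux — the per-perfect-field re-run of
`Theorems.resolutionInChar_of_liu_of_regularBlowupSingAdmQProj_of_lurel` / `patchingRel_of_liu_of_regularBlowupSingAdmQProj`. -/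
def DownstreamStatement : Prop :=
  Liu2002Thm8124Projective.{0} → (∀ p : ℕ, p.Prime → SingAdmQProjPerfect.{0} p) → PatchingRelPerfect

/-- The whole line as one implication (shape of the future `PatchingRelPerfect_of`). -/
def LineStatement : Prop :=
  KedlayaAvoidance.{0} → (∀ p : ℕ, p.Prime → AffineSpaceSingAdmPerfect.{0} p) →
    Liu2002Thm8124Projective.{0} → PatchingRelPerfect

/-- The line statement follows from the two structural theorems (pure logic; proved). -/
theorem lineStatement_of (hT : ∀ p : ℕ, p.Prime → TransportStatement.{0} p)
    (hD : DownstreamStatement) : LineStatement :=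
  fun hK hA hL => hD hL (fun p hp => hT p hp hK (hA p hp))

end Summit.ResolutionOfSingularities.ResolutionOfSingularities.Cruxes.PatchingRelPerfect.KedlayaNormTransport

end
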